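import Summits.QuantumFields.YangMills.Theorems.EquipartitionCriticalityFreeEnergyLogCoefficientAbstractB
import HarnessLib

/-!
# `FreeEnergyRate` (crux `stmt-QuantumFields-22402`), line `birth`, stub `upperRate`

Route `EntropyBudgetEquipartition` of `QuantumFields/YangMills`, crux
`Summit.QuantumFields.YangMills.Theses.EntropyBudgetEquipartition.FreeEnergyRate` (Chatterjee's
two-term free-energy asymptotics with a power rate).

QUANTITATIVE LEMMA 17.4 of S. Chatterjee, *The leading term of the Yang–Mills free energy*,
arXiv:1602.01222, for the tree's abstract one-box interface `B : OneBoxBounds d`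
(`EquipartitionCriticalityFreeEnergyLogCoefficientDefs`): given a rate `|log Z_M(B_n)/n^d − L| ≤ C/√n`
for the lattice Maxwell free energy, there is `κ > 0` (here `κ = a/4`, `a = 1/(6(d+1))`) such that
for all large `β` and, at each such `β`, all large `n`,
`T(B_n, β) ≤ (d−1) log c_H + D L + β^{−κ}`.
Proof: the tree's Lemma 17.2 in F-form at the scale `m = ⌊β^a⌋` (`OneBoxBounds.T_le_G_add`, with
the cubic chart error `≤ 8 A d² V(β)` from `OneBoxBounds.errU_sq_le` once `V(β) ≤ 1`), the
Lemma-17.3 comparison `T(B_n) ≤ T(B_m) + K₂ (2/β^a) log β` (`OneBoxBounds.T_le_T_add`, for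
`n ≥ β^{2a}`), and `|G(m) − A₀| ≤ (d+1)|log c_H|/m + D C/√m` (`abs_Gm_sub_le`); every error is
`O(β^{−a/2} log β)`, absorbed into `β^{−a/4}` eventually (`eventually_le_rpow_neg_of_tendsto`).
No definitions, no named facts.
-/

noncomputable section

namespace Summit.QuantumFields.YangMills.Theorems.FreeEnergyRate

open scoped Matrix.Norms.Frobenius ENNReal NNReal
open MeasureTheory Measure Filter Topology Set
open Literature.Probability.LatticeModels Literature.MathematicalPhysics.QuantumLattice
open Literature.MathematicalPhysics.QuantumFieldTheory
open Summit.QuantumFields.YangMills.Theorems.FreeEnergyLogCoefficient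
open ChatterjeeJointLimit WilsonWeakCoupling LatticeMaxwell ChatterjeeAssembly AxialGauge

/-! ### Generic helpers: eventual domination by a negative power -/

/-- If `β^κ E(β) → 0` then eventually `E(β) ≤ β^{−κ}`. [folklore] -/
theorem eventually_le_rpow_neg_of_tendsto {E : ℝ → ℝ} {κ : ℝ}
    (h : Tendsto (fun β : ℝ => β ^ κ * E β) atTop (𝓝 0)) :
    ∀ᶠ β : ℝ in atTop, E β ≤ β ^ (-κ) := by
  filter_upwards [h.eventually (ge_mem_nhds zero_lt_one), eventually_gt_atTop 0] with β hle hβ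
  have hpos : 0 < β ^ κ := Real.rpow_pos_of_pos hβ κ
  rw [Real.rpow_neg hβ.le]
  calc E β = (β ^ κ)⁻¹ * (β ^ κ * E β) := by field_simp
    _ ≤ (β ^ κ)⁻¹ * 1 := by gcongr
    _ = (β ^ κ)⁻¹ := mul_one _

/-- `β^κ · β^p → 0` for `κ + p < 0`. [folklore] -/
theorem tendsto_rpow_mul_rpow {κ p : ℝ} (h : κ + p < 0) :
    Tendsto (fun β : ℝ => β ^ κ * β ^ p) atTop (𝓝 0) := by
  have := tendsto_rpow_neg_atTop (by linarith : 0 < -(κ + p))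
  refine this.congr' ?_
  filter_upwards [eventually_gt_atTop 0] with β hβ
  rw [neg_neg, Real.rpow_add hβ]

/-- `β^κ · (β^p log β) → 0` for `κ + p < 0`. [folklore] -/
theorem tendsto_rpow_mul_rpow_mul_log {κ p : ℝ} (h : κ + p < 0) :
    Tendsto (fun β : ℝ => β ^ κ * (β ^ p * Real.log β)) atTop (𝓝 0) := by
  have := tendsto_rpow_mul_log (p := κ + p) h
  refine this.congr' ?_
  filter_upwards [eventually_gt_atTop 0] with β hβ
  rw [Real.rpow_add hβ]; ring

/-! ### The main term `G(m)` against its limit -/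

/-- The Maxwell-rate constant is nonnegative (take `n = 1`). [folklore] -/
theorem rate_const_nonneg {d : ℕ} {L C : ℝ}
    (hL : ∀ n : ℕ, 1 ≤ n → |logZM d n / (n : ℝ) ^ d - L| ≤ C / Real.sqrt n) : 0 ≤ C := by
  have h := hL 1 le_rfl
  simp only [Nat.cast_one, Real.sqrt_one, div_one] at h
  exact (abs_nonneg _).trans h

/-- **The main term against its limit**: for `m ≥ 1`,
`|G(m) − ((d−1) log c_H + D L)| ≤ (d+1)|log c_H|/m + D C/√m` (Lemma 17.1 `coef(m) = d−1−d/m+m^{-d}`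
and the Maxwell rate). [cite: arXiv160201222, Lemma 17.1, Thm. 15.2] -/
theorem abs_Gm_sub_le {d : ℕ} (hd : 1 ≤ d) (B : OneBoxBounds d) {L C : ℝ}
    (hL : ∀ n : ℕ, 1 ≤ n → |logZM d n / (n : ℝ) ^ d - L| ≤ C / Real.sqrt n) {m : ℕ} (hm : 1 ≤ m) :
    |B.Gm m - (((d : ℝ) - 1) * Real.log B.cH + (B.D : ℝ) * L)| ≤
      ((d : ℝ) + 1) * |Real.log B.cH| / m + (B.D : ℝ) * C / Real.sqrt m := by
  have hm0 : (0 : ℝ) < m := by exact_mod_cast hm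
  have hm1 : (1 : ℝ) ≤ m := by exact_mod_cast hm
  have hD : (0 : ℝ) ≤ (B.D : ℝ) := Nat.cast_nonneg _
  have hrate := hL m hm
  have hcoef := coef_eq (d := d) hd hm
  have hGm : B.Gm m - (((d : ℝ) - 1) * Real.log B.cH + (B.D : ℝ) * L) =
      (-(d : ℝ) / m + 1 / (m : ℝ) ^ d) * Real.log B.cH + (B.D : ℝ) * (logZM d m / (m : ℝ) ^ d - L) := by
    unfold OneBoxBounds.Gm; rw [hcoef]; ring
  rw [hGm]
  have hmd : (m : ℝ) ≤ (m : ℝ) ^ d := le_self_pow₀ hm1 (by omega)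
  have h1 : |(-(d : ℝ) / m + 1 / (m : ℝ) ^ d)| ≤ ((d : ℝ) + 1) / m := by
    have e1 : |(-(d : ℝ) / m)| = d / m := by rw [abs_div, abs_neg, Nat.abs_cast, abs_of_pos hm0]
    have e2 : |1 / (m : ℝ) ^ d| = 1 / (m : ℝ) ^ d := abs_of_nonneg (by positivity)
    have e3 : 1 / (m : ℝ) ^ d ≤ 1 / m := div_le_div_of_nonneg_left zero_le_one hm0 hmd
    calc |(-(d : ℝ) / m + 1 / (m : ℝ) ^ d)| ≤ |(-(d : ℝ) / m)| + |1 / (m : ℝ) ^ d| := abs_add_le _ _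
      _ ≤ d / m + 1 / m := by rw [e1, e2]; exact add_le_add le_rfl e3
      _ = ((d : ℝ) + 1) / m := by ring
  calc |(-(d : ℝ) / m + 1 / (m : ℝ) ^ d) * Real.log B.cH + (B.D : ℝ) * (logZM d m / (m : ℝ) ^ d - L)|
      ≤ |(-(d : ℝ) / m + 1 / (m : ℝ) ^ d) * Real.log B.cH| + |(B.D : ℝ) * (logZM d m / (m : ℝ) ^ d - L)| :=
        abs_add_le _ _
    _ = |(-(d : ℝ) / m + 1 / (m : ℝ) ^ d)| * |Real.log B.cH| + (B.D : ℝ) * |logZM d m / (m : ℝ) ^ d - L| := by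
        rw [abs_mul, abs_mul, abs_of_nonneg hD]
    _ ≤ ((d : ℝ) + 1) / m * |Real.log B.cH| + (B.D : ℝ) * (C / Real.sqrt m) := by
        gcongr
    _ = ((d : ℝ) + 1) * |Real.log B.cH| / m + (B.D : ℝ) * C / Real.sqrt m := by ring

/-! ### Stub `upperRate` -/

/-- `V(β) ≥ 0` for `β ≥ 1` and `C ≥ 0`. [folklore] -/
theorem Vf_nonneg {d : ℕ} {C β : ℝ} (hC : 0 ≤ C) (hβ : 1 ≤ β) : 0 ≤ Vf d C β := by
  unfold Vf
  have hlog : 0 ≤ Real.log β := Real.log_nonneg hβ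
  have hβ0 : 0 ≤ β := by linarith
  have h1 : 0 ≤ β ^ (-(1 / 6 : ℝ)) := Real.rpow_nonneg hβ0 _
  have h2 : 0 ≤ β ^ (aU d - 1 / 3) := Real.rpow_nonneg hβ0 _
  have h3 : 0 ≤ Real.log 2 := Real.log_nonneg one_le_two
  positivity

/-- **Stub `upperRate` of line `birth`** (quantitative Lemma 17.4): for an abstract one-box
interface `B` and a Maxwell rate `|log Z_M(B_n)/n^d − L| ≤ C/√n`, there is `κ > 0` such that for
all large `β` and, at each such `β`, all large `n`, `T(B_n, β) ≤ (d−1) log c_H + D L + β^{−κ}`.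
[cite: arXiv160201222, Lemmas 17.2–17.4] -/
theorem stub_upperRate {d : ℕ} (hd : 2 ≤ d) (B : OneBoxBounds d) {L C : ℝ}
    (hL : ∀ n : ℕ, 1 ≤ n → |ChatterjeeAssembly.logZM d n / (n : ℝ) ^ d - L| ≤ C / Real.sqrt n) :
    ∃ κ : ℝ, 0 < κ ∧ ∀ᶠ β : ℝ in atTop, ∀ᶠ n : ℕ in atTop,
      B.T n β ≤ ((d : ℝ) - 1) * Real.log B.cH + (B.D : ℝ) * L + β ^ (-κ) := by
  have hd1 : 1 ≤ d := by omega
  have hC0 : 0 ≤ C := rate_const_nonneg hL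
  have hC71 := B.C71_pos
  have hA := B.A_nonneg
  have hK₂ := B.K₂_nonneg
  have hD : (0 : ℝ) ≤ (B.D : ℝ) := Nat.cast_nonneg _
  set a := aU d with ha
  have ha0 : 0 < a := aU_pos
  have ha6 : a ≤ 1 / 6 := aU_le
  set κ := a / 4 with hκ
  refine ⟨κ, by positivity, ?_⟩
  set A₀ : ℝ := ((d : ℝ) - 1) * Real.log B.cH + (B.D : ℝ) * L with hA₀
  -- the total error and its eventual absorption into `β^{-κ}`
  set P : ℝ := 2 * (((d : ℝ) + 1) * |Real.log B.cH| + Real.log 2) with hP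
  set Q : ℝ := 2 * B.K₂ with hQ
  set R : ℝ := (B.D : ℝ) * C * Real.sqrt 2 with hR
  set S : ℝ := 8 * B.A * (d : ℝ) ^ 2 with hS
  set E : ℝ → ℝ := fun β => P * β ^ (-a) + Q * (β ^ (-a) * Real.log β) + R * β ^ (-(a / 2)) +
    S * Vf d B.C71 β with hE
  have hEt : Tendsto (fun β => β ^ κ * E β) atTop (𝓝 0) := by
    have t1 := (tendsto_rpow_mul_rpow (κ := κ) (p := -a) (by linarith)).const_mul P
    have t2 := (tendsto_rpow_mul_rpow_mul_log (κ := κ) (p := -a) (by linarith)).const_mul Q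
    have t3 := (tendsto_rpow_mul_rpow (κ := κ) (p := -(a / 2)) (by linarith)).const_mul R
    have t4 := (tendsto_rpow_mul_rpow_mul_log (κ := κ) (p := -(1 / 6 : ℝ)) (by linarith)).const_mul
      (S * (2 * d * B.C71))
    have t5 := (tendsto_rpow_mul_rpow (κ := κ) (p := aU d - 1 / 3) (by linarith)).const_mul
      (S * (2 * d * Real.log 2))
    have hsum := ((t1.add t2).add t3).add (t4.add t5)
    simp only [mul_zero, add_zero] at hsum
    refine hsum.congr' (Eventually.of_forall fun β => ?_)
    simp only [hE, Vf]
    ring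
  have hev : ∀ᶠ β : ℝ in atTop, 2 ≤ β ∧ Sbar d B.C71 β ≤ (B.r₁ / 2) ^ 2 ∧ Vf d B.C71 β ≤ 1 ∧
      (2 : ℝ) ≤ β ^ a ∧ E β ≤ β ^ (-κ) := by
    refine (eventually_ge_atTop 2).and (Eventually.and ?_ (Eventually.and ?_ (Eventually.and ?_ ?_)))
    · exact (OneBoxBounds.tendsto_Sbar (d := d) B.C71).eventually
        (ge_mem_nhds (by have := B.r₁_pos; positivity))
    · exact (tendsto_Vf (d := d) B.C71).eventually (ge_mem_nhds zero_lt_one)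
    · exact (tendsto_rpow_atTop ha0).eventually_ge_atTop _
    · exact eventually_le_rpow_neg_of_tendsto hEt
  filter_upwards [hev] with β ⟨hβ2, hSb, hV1, ha2, hEle⟩
  have hβ0 : 0 < β := by linarith
  have hβ1 : 1 ≤ β := by linarith
  have hL0 : 0 ≤ Real.log β := Real.log_nonneg hβ1
  have hβa0 : 0 < β ^ a := Real.rpow_pos_of_pos hβ0 a
  -- the scale `m = ⌊β^a⌋`
  set m := ⌊β ^ a⌋₊ with hm
  have hma : (m : ℝ) ≤ β ^ a := Nat.floor_le hβa0.le
  have hmb : β ^ a - 1 < m := Nat.sub_one_lt_floor _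
  have hm2 : β ^ a ≤ 2 * m := by linarith
  have hm1r : (1 : ℝ) < m := by linarith
  have hm1 : 1 ≤ m := by exact_mod_cast hm1r.le
  have hm0 : (0 : ℝ) < m := by positivity
  filter_upwards [eventually_ge_atTop (m + 1), eventually_ge_atTop ⌈β ^ a * β ^ a⌉₊] with n hn1 hn2
  have hn2' : β ^ a * β ^ a ≤ n := Nat.ceil_le.1 hn2
  have hn0 : (0 : ℝ) < n := lt_of_lt_of_le (by positivity) hn2'
  -- Lemma 17.3: compare `n` with `m`, `w = 2/β^a`
  have hw1 : (m : ℝ) / n ≤ 2 / β ^ a := by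
    rw [div_le_div_iff₀ hn0 hβa0]
    nlinarith
  have hw2 : 1 / (m : ℝ) ≤ 2 / β ^ a := by
    rw [div_le_div_iff₀ hm0 hβa0]; linarith
  have hcmp := B.T_le_T_add hd1 hβ2 hm1 hn1 hw1 hw2
  -- Lemma 17.2 at `m`
  have hρ := B.rho0_le_half_r₁ hβ1 hma hSb
  have hTm := B.T_le_G_add hβ2 hm1 hρ
  -- the cubic error `≤ S V(β)`
  set U : ℝ := B.A * β * (2 * rho0 B.C71 d m β) ^ 3 * ((d : ℝ) * d) with hU
  have hU0 : 0 ≤ U := by have := rho0_nonneg B.C71 d m β; positivity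
  have hV0 : 0 ≤ Vf d B.C71 β := Vf_nonneg hC71.le hβ1
  have hVmax : max (Vf d B.C71 β) 0 = Vf d B.C71 β := max_eq_left hV0
  have hUsq := B.errU_sq_le hβ1 hma
  rw [hVmax] at hUsq
  have hUle : U ≤ S * Vf d B.C71 β := by
    have hV3 : Vf d B.C71 β ^ 3 ≤ Vf d B.C71 β ^ 2 := pow_le_pow_of_le_one hV0 hV1 (by norm_num)
    have h2 : U ^ 2 ≤ (S * Vf d B.C71 β) ^ 2 := by
      calc U ^ 2 ≤ 64 * B.A ^ 2 * (d : ℝ) ^ 4 * Vf d B.C71 β ^ 3 := hUsq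
        _ ≤ 64 * B.A ^ 2 * (d : ℝ) ^ 4 * Vf d B.C71 β ^ 2 := by gcongr
        _ = (S * Vf d B.C71 β) ^ 2 := by rw [hS]; ring
    exact (pow_le_pow_iff_left₀ hU0 (by positivity) two_ne_zero).1 h2
  -- the main term
  have hG := abs_Gm_sub_le hd1 B hL hm1
  have hG' : B.Gm m ≤ A₀ + ((d : ℝ) + 1) * |Real.log B.cH| / m + (B.D : ℝ) * C / Real.sqrt m := by
    have := (abs_le.1 hG).2; linarith
  -- conversions `1/m ≤ 2β^{-a}`, `1/√m ≤ √2 β^{-a/2}`, `1/m^d ≤ 1/m`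
  have hinv : 1 / (m : ℝ) ≤ 2 * β ^ (-a) := by
    rw [Real.rpow_neg hβ0.le, ← div_eq_mul_inv]; exact hw2
  have hmd : (m : ℝ) ≤ (m : ℝ) ^ d := le_self_pow₀ hm1r.le (by omega)
  have hinvd : 1 / (m : ℝ) ^ d ≤ 2 * β ^ (-a) :=
    (div_le_div_of_nonneg_left zero_le_one hm0 hmd).trans hinv
  have hsqrt : 1 / Real.sqrt m ≤ Real.sqrt 2 * β ^ (-(a / 2)) := by
    have h1 : Real.sqrt (1 / (m : ℝ)) ≤ Real.sqrt (2 * β ^ (-a)) := Real.sqrt_le_sqrt hinv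
    rw [Real.sqrt_div' 1 hm0.le, Real.sqrt_one, Real.sqrt_mul' 2 (Real.rpow_nonneg hβ0.le _),
      Real.sqrt_eq_rpow (β ^ (-a)), ← Real.rpow_mul hβ0.le] at h1
    have e : -a * (1 / (2 : ℝ)) = -(a / 2) := by ring
    rwa [e] at h1
  -- assemble
  have e1 : ((d : ℝ) + 1) * |Real.log B.cH| / m ≤ ((d : ℝ) + 1) * |Real.log B.cH| * (2 * β ^ (-a)) := by
    rw [div_eq_mul_one_div]
    exact mul_le_mul_of_nonneg_left hinv (by positivity)
  have e2 : (B.D : ℝ) * C / Real.sqrt m ≤ (B.D : ℝ) * C * (Real.sqrt 2 * β ^ (-(a / 2))) := by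
    rw [div_eq_mul_one_div]
    exact mul_le_mul_of_nonneg_left hsqrt (by positivity)
  have e3 : Real.log 2 / (m : ℝ) ^ d ≤ Real.log 2 * (2 * β ^ (-a)) := by
    rw [div_eq_mul_one_div]
    exact mul_le_mul_of_nonneg_left hinvd (Real.log_nonneg one_le_two)
  have e4 : B.K₂ * (2 / β ^ a * Real.log β) = Q * (β ^ (-a) * Real.log β) := by
    rw [hQ, Real.rpow_neg hβ0.le]; ring
  have hEβ : E β = P * β ^ (-a) + Q * (β ^ (-a) * Real.log β) + R * β ^ (-(a / 2)) +
      S * Vf d B.C71 β := rfl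
  have htot : B.T n β ≤ A₀ + E β := by
    rw [hEβ, hP, hR]
    linarith [hcmp, hTm, hUle, hG', e1, e2, e3, e4]
  linarith

end Summit.QuantumFields.YangMills.Theorems.FreeEnergyRate

end
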